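import Literature.NumberTheory.LFunctions.CertifiedDirichletLTuringHadamardSingle
import HarnessLib

/-!
# Turing's bound `|∫S(t,χ)dt| ≤ 2.26 + 0.0642 log(qt₂/2π)` for every primitive character — computational wrapper

Companion of `CertifiedDirichletLTuringHadamardSingle.lean` (Trudgian 2011 Lemma 3.7 / Theorem 3.8
for ONE primitive character via the genus-one Hadamard product of `ξ(s,χ)`).  That file proves the
numerical bound granted the certified `ζ` computation `TrudgianNumerics.trudgianCheck = true`; here the
hypothesis is discharged by the tree's `native_decide` evaluation `TrudgianNumerics.trudgianCheck_eq_true`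
(file `TuringMethodTrudgianNumericsCheck.lean`), exactly as in `CertifiedDirichletLTuringNumericsHolds.lean`
and `CertifiedDirichletLTuringSingle.lean`.  COMPUTATIONAL node: the only non-standard axiom is that
`native_decide` certificate.

## References
* T. S. Trudgian, Improvements to Turing's method, Math. Comp. 80 (2011), §3.5, Theorem 3.8. [Trudgian2011]
* R. Rumely, Math. Comp. 61 (1993), Theorem 2 p. 429. [Rumely1993ERH]
-/

noncomputable section

open Complex Set MeasureTheory intervalIntegral Filter Topology
open scoped Real

namespace Literature.NumberTheory.LFunctions

open DirichletTheta DirichletCharacter ExplicitPsiChar Trudgian2011Dirichlet TrudgianNumerics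

namespace TuringDirichlet

variable {q : ℕ} [NeZero q] {χ : DirichletCharacter ℂ q}

/-- **Numerical Turing bound for EVERY primitive character** (hypothesis-free; the certified `ζ`
computation enters through the tree's `native_decide` evaluation `trudgianCheck_eq_true`): for `χ`
primitive modulo `q > 1` and `50 < t₁ ≤ t₂`, `t₁`, `t₂` ordinates of no non-trivial zero of `L(s,χ)`,
**`|∫_{t₁}^{t₂} S(t,χ) dt| ≤ 2.26 + 0.0642 log(qt₂/2π)`** — the bound the tree had for quadratic `χ`
only (`abs_integral_lfunctionArgS_le_numeric_of_isQuadratic`), now for all primitive `χ` by the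
genus-one Hadamard product.  (Printed: Rumely `1.8397 + 0.1242 log(qt₂/2π)`, Trudgian
`1.975 + 0.084 log(qt₂/2π)`.) [cite: Trudgian2011, §3.5] [cite: Rumely1993ERH, Theorem 2 p. 429] -/
theorem abs_integral_lfunctionArgS_le_numeric (hq : 1 < q) (hχ : χ.IsPrimitive) {t₁ t₂ : ℝ}
    (h01 : 50 < t₁) (h12 : t₁ ≤ t₂)
    (hz₁ : ∀ ρ ∈ charNontrivialZeros χ, ρ.im ≠ t₁) (hz₂ : ∀ ρ ∈ charNontrivialZeros χ, ρ.im ≠ t₂) :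
    |∫ t in t₁..t₂, lfunctionArgS χ t| ≤ 2.26 + 0.0642 * Real.log (q * t₂ / (2 * π)) :=
  abs_integral_lfunctionArgS_le_numeric_of_check trudgianCheck_eq_true hq hχ h01 h12 hz₁ hz₂

end TuringDirichlet

end Literature.NumberTheory.LFunctions

end
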